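import Literature.AlgebraicGeometry.Frobenioids.ArchimedeanBasicProperties
import Mathlib.CategoryTheory.PEmpty
import Mathlib.CategoryTheory.Functor.Const
import HarnessLib

/-!
# Frobenioids II, Theorem 3.6 (i)/(iii): the schemata `Thm36i_istrModel F FM`, `Thm36i_untrEquiv FU FR`,
# `Thm36iii_equivalence F isom istrA istrC isomI e FCi` (FACT-LIST F-0691 / F-0693 / F-0694) have
# REFUTABLE universal closures — they are facts AT THE NAMED INSTANCES only

Mochizuki, *The geometry of Frobenioids II: poly-Frobenioids*, Kyushu J. Math. **62** (2008) 401–460,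
§3, Theorem 3.6 (i) p. 36 ("`(C^Λ)^istr` is of … model type, with rational function monoid naturally
isomorphic to `(Φ^fld)^Λ`"; "For arbitrary `Λ`, there is a natural equivalence of categories
`(C^Λ)^un-tr ⥲ C^ℝ`, compatible with the Frobenioid structures") and Theorem 3.6 (iii) p. 37 ("determines
an equivalence of categories `C ⥲ A ×_{A^istr} C^istr` that is 1-compatible with the natural functors to
`F_Φ`") [cite: MochizukiFrdII2008, Thm 3.6 pp.36-38].

Negative knowledge recorded next to `ArchimedeanBasicProperties.lean` (abc-iut-L1-t9), PROOF-ONLY (no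
definition, no instance), abc-iut cell seat abc-iut-f-007 (block F, FACT-LIST rows **F-0691**
`ArchFrd.Thm36i_istrModel`, **F-0693** `ArchFrd.Thm36i_untrEquiv`, **F-0694** `ArchFrd.Thm36iii_equivalence`;
class `preparatory`, kernel_closedness `parametrised`).

The three rows are PARAMETRISED predicates.  As the statement file says ("Schema label … NO OTHER binding
is a statement of the paper … Consumers cite the instances, never these schemas at a binding of their
own"), each binds its SUBJECT — the pre-Frobenioid structure functor(s) and the comparison data — as
free parameters:

* `Thm36i_istrModel F FM := ∃ e : F^istr ≌ M, Nonempty (e.functor ⋙ FM ≅ istr F)` for ARBITRARY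
  `F : X → F_Φ`, `FM : M → F_Φ`;
* `Thm36i_untrEquiv FU FR := ∃ e : U ≌ R, Nonempty (e.functor ⋙ FR ≅ FU)` for ARBITRARY `FU`, `FR`;
* `Thm36iii_equivalence F isom istrA istrC isomI e FCi := (toCFP …).IsEquivalence ∧ OneCommutes …` for
  ARBITRARY categories `X, XA, XAi, Xi` and functors between them.

So the UNIVERSAL closures say "any two categories over `F_Φ` are equivalent" and are false; this file
supplies the kernel objects, at the smallest possible data (base `D = 𝟙` the one-object category with
the trivial divisor monoid `Φ_𝟙 = constMonoidOn PUnit`, [FrdI] Def. 1.1 (iii)): the EMPTY category over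
`F_Φ` versus the ONE-OBJECT category over `F_Φ`:

* `not_thm36i_istrModel_empty` / `not_forall_thm36i_istrModel` (F-0691);
* `not_thm36i_untrEquiv_empty` / `not_forall_thm36i_untrEquiv` (F-0693);
* `not_thm36iii_equivalence_empty` / `not_forall_thm36iii_equivalence` (F-0694).

The INSTANCE forms at the categories of Example 3.3 — the only statements of the paper — are PROVED in the
tree and are what consumers bind: F-0691 ⟶ `ArchFrd.thm36i_istrModel_C` (`Λ = ℤ`,
`ArchimedeanFieldModel.lean`, FACT-LIST F-0869 ✓) and `ArchFrd.Thm36Sub.istrModel_R_holds` (`Λ = ℝ`,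
`Thm36SubRlfModel.lean`); F-0693 ⟶ `ArchFrd.Thm36Sub.untrEquiv_Z_holds`, `ArchFrd.Thm36Sub.untrEquiv_R_holds`
(`Thm36SubModelProofs.lean`, closing the slots of `Thm36SubModel.lean`); F-0694 ⟶
`ArchFrd.thm36iii_equivalence_C` / `ArchFrd.Thm36iii_equivalence_C_holds` (`ArchimedeanIsometrizationEquivalence.lean`,
FACT-LIST F-0856 ✓).  (The `Λ = ℚ` readings of (i) are recorded as not typed in `Thm36SubModel.lean`.)
So each row is admissible ONLY in its instance form (FACT-LIST class «universal-closure REFUTED; instance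
form PROVED»).  Elementary category theory; nothing here bears on the disputed [IUTchIII] Cor. 3.12 or
takes a side; refuted-as-schema is a statement about OUR typing, not about the paper.
-/

namespace Literature.AlgebraicGeometry.Frobenioids

namespace ArchFrd

open CategoryTheory

/-! ### The witnesses

Throughout, the base is the one-object category `𝟙 = Discrete PUnit` with the trivial divisor monoid
`Φ_𝟙 := constMonoidOn PUnit` ([FrdI] Def. 1.1 (iii)); `F_{Φ_𝟙}` has the unique object
`ElemFrobenioid.of Φ_𝟙 ⋆`; the two categories over `F_{Φ_𝟙}` compared are the EMPTY one
(`Functor.empty (F_{Φ_𝟙})`) and the ONE-OBJECT one (`(Functor.const 𝟙).obj ⋆`). -/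

/-! ### F-0691: `Thm36i_istrModel` -/

/-- **F-0691, universal closure false:** the empty pre-Frobenioid has no isotropic objects, so
`(∅)^istr` is not equivalent to the one-object category over `F_Φ` — `Thm36i_istrModel F FM` fails at
`F := ∅ → F_{Φ_𝟙}`, `FM := 𝟙 → F_{Φ_𝟙}`. [cite: MochizukiFrdII2008, Thm 3.6 (i) p.36] -/
theorem not_thm36i_istrModel_empty :
    ¬ Thm36i_istrModel (Functor.empty (ElemFrobenioid (constMonoidOn PUnit.{1})))
        ((Functor.const (Discrete PUnit.{1})).obj
          (ElemFrobenioid.of (constMonoidOn PUnit.{1}) (Discrete.mk PUnit.unit))) := by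
  rintro ⟨e, -⟩
  exact (e.inverse.obj (Discrete.mk PUnit.unit)).obj.as.elim

/-- **F-0691 as a schema is not a fact:** the fully quantified closure of `ArchFrd.Thm36i_istrModel`
(over all bases, divisor monoids, structure functors `F` and model functors `FM`, at universe level `0`)
is FALSE.  The printed claim is the instance family `ArchFrd.thm36i_istrModel_C` /
`ArchFrd.Thm36Sub.istrModel_R_holds`. [cite: MochizukiFrdII2008, Thm 3.6 (i) p.36] -/
theorem not_forall_thm36i_istrModel :
    ¬ ∀ {D : Type} [Category.{0} D] {Φ : Dᵒᵖ ⥤ CommMonCat.{0}} {X : Type} [Category.{0} X]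
        (F : X ⥤ ElemFrobenioid Φ) {M : Type} [Category.{0} M] (FM : M ⥤ ElemFrobenioid Φ),
        Thm36i_istrModel F FM :=
  fun h => not_thm36i_istrModel_empty
    (h (Functor.empty (ElemFrobenioid (constMonoidOn PUnit.{1})))
      ((Functor.const (Discrete PUnit.{1})).obj
        (ElemFrobenioid.of (constMonoidOn PUnit.{1}) (Discrete.mk PUnit.unit))))

/-! ### F-0693: `Thm36i_untrEquiv` -/

/-- **F-0693, universal closure false:** the empty category over `F_Φ` is not equivalent to the
one-object category over `F_Φ` — `Thm36i_untrEquiv FU FR` fails at `FU := ∅ → F_{Φ_𝟙}`,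
`FR := 𝟙 → F_{Φ_𝟙}`. [cite: MochizukiFrdII2008, Thm 3.6 (i) p.36] -/
theorem not_thm36i_untrEquiv_empty :
    ¬ Thm36i_untrEquiv (Functor.empty (ElemFrobenioid (constMonoidOn PUnit.{1})))
        ((Functor.const (Discrete PUnit.{1})).obj
          (ElemFrobenioid.of (constMonoidOn PUnit.{1}) (Discrete.mk PUnit.unit))) := by
  rintro ⟨e, -⟩
  exact (e.inverse.obj (Discrete.mk PUnit.unit)).as.elim

/-- **F-0693 as a schema is not a fact:** the fully quantified closure of `ArchFrd.Thm36i_untrEquiv`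
(at universe level `0`) is FALSE.  The printed claim "`(C^Λ)^un-tr ⥲ C^ℝ` compatible with the Frobenioid
structures" is the instance family `ArchFrd.Thm36Sub.untrEquiv_Z_holds` / `untrEquiv_R_holds`.
[cite: MochizukiFrdII2008, Thm 3.6 (i) p.36] -/
theorem not_forall_thm36i_untrEquiv :
    ¬ ∀ {D : Type} [Category.{0} D] {Φ : Dᵒᵖ ⥤ CommMonCat.{0}} {U : Type} [Category.{0} U]
        {R : Type} [Category.{0} R] (FU : U ⥤ ElemFrobenioid Φ) (FR : R ⥤ ElemFrobenioid Φ),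
        Thm36i_untrEquiv FU FR :=
  fun h => not_thm36i_untrEquiv_empty
    (h (Functor.empty (ElemFrobenioid (constMonoidOn PUnit.{1})))
      ((Functor.const (Discrete PUnit.{1})).obj
        (ElemFrobenioid.of (constMonoidOn PUnit.{1}) (Discrete.mk PUnit.unit))))

/-! ### F-0694: `Thm36iii_equivalence` -/

/-- **F-0694, universal closure false:** with `C := ∅` and `A = A^istr = C^istr := 𝟙` (all comparison
functors the empty functor / the identity), the categorical fiber product `A ×_{A^istr} C^istr` has the
object `(⋆, ⋆, id)`, so the functor from `C = ∅` into it is not an equivalence —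
`Thm36iii_equivalence` fails at this binding. [cite: MochizukiFrdII2008, Thm 3.6 (iii) p.37] -/
theorem not_thm36iii_equivalence_empty :
    ¬ Thm36iii_equivalence (Functor.empty (ElemFrobenioid (constMonoidOn PUnit.{1})))
        (Functor.empty (Discrete PUnit.{1})) (𝟭 (Discrete PUnit.{1}))
        (Functor.empty (Discrete PUnit.{1})) (𝟭 (Discrete PUnit.{1})) (Iso.refl _)
        ((Functor.const (Discrete PUnit.{1})).obj
          (ElemFrobenioid.of (constMonoidOn PUnit.{1}) (Discrete.mk PUnit.unit))) := by
  rintro ⟨hE, -⟩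
  let c : CFP (𝟭 (Discrete PUnit.{1})) (𝟭 (Discrete PUnit.{1})) :=
    ⟨Discrete.mk PUnit.unit, Discrete.mk PUnit.unit, Iso.refl _⟩
  exact ((toCFP (𝟭 (Discrete PUnit.{1})) (𝟭 (Discrete PUnit.{1}))
    (Functor.empty (Discrete PUnit.{1})) (Functor.empty (Discrete PUnit.{1}))
    (Iso.refl _)).inv.obj c).as.elim

/-- **F-0694 as a schema is not a fact:** the fully quantified closure of `ArchFrd.Thm36iii_equivalence`
(at universe level `0`) is FALSE.  The printed claim is the instance `ArchFrd.thm36iii_equivalence_C`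
(exact-name witness `ArchFrd.Thm36iii_equivalence_C_holds`, FACT-LIST F-0856).
[cite: MochizukiFrdII2008, Thm 3.6 (iii) p.37] -/
theorem not_forall_thm36iii_equivalence :
    ¬ ∀ {D : Type} [Category.{0} D] {Φ : Dᵒᵖ ⥤ CommMonCat.{0}} {X : Type} [Category.{0} X]
        (F : X ⥤ ElemFrobenioid Φ) {XA : Type} [Category.{0} XA] {XAi : Type} [Category.{0} XAi]
        {Xi : Type} [Category.{0} Xi] (isom : X ⥤ XA) (istrA : XA ⥤ XAi) (istrC : X ⥤ Xi)
        (isomI : Xi ⥤ XAi) (e : isom ⋙ istrA ≅ istrC ⋙ isomI) (FCi : Xi ⥤ ElemFrobenioid Φ),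
        Thm36iii_equivalence F isom istrA istrC isomI e FCi :=
  fun h => not_thm36iii_equivalence_empty
    (h (Functor.empty (ElemFrobenioid (constMonoidOn PUnit.{1})))
      (Functor.empty _) (𝟭 _) (Functor.empty _) (𝟭 _) (Iso.refl _)
      ((Functor.const (Discrete PUnit.{1})).obj
        (ElemFrobenioid.of (constMonoidOn PUnit.{1}) (Discrete.mk PUnit.unit))))

end ArchFrd

end Literature.AlgebraicGeometry.Frobenioids
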